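/-
Copyright (c) 2026 the pub-hodgecm-mathlib formalisation cell (harness21).  Prover seat hodgecm-mathlib-K2E3-p11 (g6), Track B «K2-LIT» ∕ h413
(`stmt-HodgeConjecture-24833`), line `K2_E3_EllipticInputs`, road (11-3-split-nsc) `sig_K2E3CharLocIntNearSemisimpleSplitThreeNonSupercuspidal` (U12 ED. 20 :419),
brick (nsc-K𝔭-AC): THE `K M U` PUSH-FORWARD FOR THE MAXIMAL PARABOLIC `P₍₂,₁₎ ⊂ GL₃(F)` IS ABSOLUTELY CONTINUOUS (hypothesis-free).  2026-09-04.
-/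
import Summits.HodgeConjecture.HodgeConjecture.Theorems.K2E3GL3BorelKMUDomination              -- ★ (K2E3-p17 g7): `addHaar_image_val_eq_zero_of_haar_eq_zero` (Haar-null ⇒ `μ𝔤`-null image) + the `GL₃` frame
import Summits.HodgeConjecture.HodgeConjecture.Theorems.K2E3GL3ParabolicLeviUnipotentCoordinates -- ★ p858538 (K2E3-p03 g5): `exists_lintegral_levi_unipotent_eq_mul_lintegral_pi` ((nsc-K𝔭-MU), `F⁷` coordinates)
import Summits.HodgeConjecture.HodgeConjecture.Theorems.K2E3GL3ParabolicSliceDensityAE         -- ★ (K2E3-p11 g5): `exists_lintegral_parabolicSlice_eq_lintegral_mul_density` (the `ℝ≥0∞` (LBGL-3E) identity)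
import Summits.HodgeConjecture.HodgeConjecture.Theorems.K2E3GL3CharpolyDiscNull                 -- ★ H″4 (K2E3-p17 g6): `pi_setOf_discr_charpoly_parabolic_eq_zero` (the parabolic discriminant locus is `dx⁷`-null)
import HarnessLib

/-!
# K2_E3 road (h413), (11-3-split-nsc) brick (nsc-K𝔭-AC) — the `K × M₍₂,₁₎ × U₍₂,₁₎` push-forward `(k, m, u) ↦ k⁻¹ (m u) k` charges no Haar-null set of `GL₃(F)`

Cell `pub/hodgecm-mathlib` (D-0151), Track B, seat K2E3-p11 (g6) = road owner of (11-3-split-nsc) (BRICK LIST v2, `K2/STATUS.md` 2026-09-04 ≈08:11Z).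
`--supports stmt-HodgeConjecture-24833 --as helper`; THEOREMS ONLY (no definition ∕ instance ∕ notation ∕ named fact ∕ `sorry`); never imports `Cruxes/…/Lines`.
COUNT-NEUTRAL.  This is the (AC) hypothesis of ★ (nsc-vD-gen) `K2E3CharLocIntNearParabolicIndOfAC.charLocIntNear_parabolicIndGL_of_ac` for the label
`![false, false, true]` (the standard parabolic `P₍₂,₁₎ = {g | g₂₀ = g₂₁ = 0}`), HYPOTHESIS-FREE; the Borel twin is ★ `K2E3GL3BorelKMUDomination.borelKMU_null_of_haar_null`
(K2E3-p17 (g7)), whose proof pattern (§§1–3 there) this file follows token for token with `F⁶ ↦ F⁷`, `b(r) ↦ Y(r) = !![r₀,r₁,r₂; r₃,r₄,r₅; 0,0,r₆]`, ★ (3J) ↦ ★ (3E).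

THE MATHEMATICS ([HarishChandra1970, Part V §4 Lemma 22 (submersion principle)]; [vanDijk1972, Thm. p. 237]; [WeilBNT1967, Ch. I §4, Ch. II §5]).  `K = GL₃(𝒪)`,
`M = M₍₂,₁₎ ≅ GL₂ × GL₁`, `U = U₍₂,₁₎ ≅ F²`, Haar measures `κ, ν_M, μ_U`, `μ_G` a Haar measure of `G = GL₃(F)`, `A ⊆ G` measurable with `μ_G(A) = 0`.  (i) `μ_G`-null ⇒
`μ𝔤`-null image `E = val A ⊆ M₃(F)` (★ Weil, K2E3-p17's lemma).  (ii) The `ℝ≥0∞` slice identity ★ (3E) `∫_K ∫_{F⁷} h(k Y(r) k⁻¹) dr dκ = ∫ h·w dμ𝔤` at `h = 1_E` gives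
`∫_K dx⁷{r | k Y(r) k⁻¹ ∈ E} dκ = ∫_E w dμ𝔤 = 0`, so `dx⁷{r | k Y(r) k⁻¹ ∈ E} = 0` for `κ`-a.e. `k`.  (iii) ★ (MU) (K2E3-p03): `(m,u) ↦ m u` carries `ν_M ⊗ μ_U` to
`c · 1_{det A ≠ 0, b ≠ 0} · ‖det A‖⁻³‖b‖⁻¹ · dx⁷` in the coordinates `Y(r)`, so `dx⁷{r | Y(r) ∈ E'} = 0 ⇒ (ν_M ⊗ μ_U){(m,u) | m u ∈ E'} = 0` (§1); apply at
`E' = k⁻¹ E k`.  (iv) `κ` is inversion-invariant (`K` compact), turning `k Y k⁻¹` into `k⁻¹ Y k`.  (v) Tonelli (`measure_prod_null_of_ae_null`).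

* §1 `prod_null_of_levi_unipotent` — (iii): `dx⁷{r | Y(r) ∈ E} = 0 ⇒ (ν_M ⊗ μ_U){(m,u) | ↑(m u) ∈ E} = 0` (from ★ p858538).
* §2 **`parabolicKMU_null_of_haar_null`** — the (AC) statement in EXACTLY the shape consumed by the (nsc) tie (`probe_ac_twoOne` of the cand
  `K2/K2E3-p11/g6/tie_113nsc.cand.v0.K2E3-p11-g6.lean`): `∀ F … (μ₀) (νM) (μU) (μK) (A), MeasurableSet A → μ₀ A = 0 → (μK ⊗ (νM ⊗ μU)){(k,m,u) | k⁻¹(mu)k ∈ A} = 0`.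

HONEST LABEL: HC_CM is proved only modulo the 7 printed citations (2 remaining named inputs: hLiu418 = stmt-HodgeConjecture-24832, h413 =
stmt-HodgeConjecture-24833) until rung 0 closes; count-neutral helper.

## References
* [HarishChandra1970] Harish-Chandra (notes by G. van Dijk), *Harmonic Analysis on Reductive p-adic Groups*, LNM 162 (1970), Part V §4 Lemma 22.
* [vanDijk1972] G. van Dijk, *Computation of certain induced characters of 𝔭-adic groups*, Math. Ann. 199 (1972), Thm. p. 237.
* [WeilBNT1967] A. Weil, *Basic Number Theory* (1967), Ch. I §4, Ch. II §5.
-/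

set_option autoImplicit false
set_option linter.dupNamespace false

noncomputable section

open MeasureTheory MeasureTheory.Measure Set Function Topology Filter Matrix
open scoped NNReal ENNReal MatrixGroups Pointwise
open Literature.NumberTheory.GaloisRepresentations Literature.NumberTheory.GaloisRepresentations.IsNonarchimedeanLocalField
open Literature.NumberTheory.Automorphic Literature.NumberTheory.Weil1964
open Summit.HodgeConjecture.HodgeConjecture.Cruxes.H413.K2E3GL3BorelKMUDomination
open Summit.HodgeConjecture.HodgeConjecture.Cruxes.H413.K2E3GL3ParabolicLeviUnipotentCoordinates
open Summit.HodgeConjecture.HodgeConjecture.Cruxes.H413.K2E3GL3ParabolicSliceDensityAE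

namespace Summit.HodgeConjecture.HodgeConjecture.Cruxes.H413.K2E3GL3ParabolicKMUAbsCont

/-! ## §1  (MU) in null-set form: `dx⁷{r | Y(r) ∈ E} = 0 ⇒ (ν_M ⊗ μ_U){(m,u) | ↑(m u) ∈ E} = 0` -/

section MU

variable {F : Type*} [Field F] [ValuativeRel F] [TopologicalSpace F] [IsNonarchimedeanLocalField F]
  [MeasurableSpace F] [BorelSpace F] [MeasurableSpace (GL (Fin 3) F)] [BorelSpace (GL (Fin 3) F)]
  [MeasurableSpace (Matrix (Fin 3) (Fin 3) F)] [BorelSpace (Matrix (Fin 3) (Fin 3) F)]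

/-- **(nsc-K𝔭-MU), null-set corollary**: for Haar measures `ν_M` on `M₍₂,₁₎`, `μ_U` on `U₍₂,₁₎` and `dx` on `F`, a measurable `E ⊆ M₃(F)` whose slice preimage
`{r ∈ F⁷ | Y(r) ∈ E}` is `dx⁷`-null has `(ν_M ⊗ μ_U){(m,u) | ↑(m u) ∈ E} = 0` — ★ `exists_lintegral_levi_unipotent_eq_mul_lintegral_pi` at `g = 1_E`: the right-hand
integrand lives on the null preimage. [cite: WeilBNT1967, Ch. II §5] [cite: HarishChandra1970, Part V §4 Lemma 22] -/
theorem prod_null_of_levi_unipotent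
    (νM : Measure ↥(standardLeviGL F (![false, false, true] : Fin 3 → Bool))) [IsHaarMeasure νM]
    (μU : Measure ↥(unipotentRadicalGL F (![false, false, true] : Fin 3 → Bool))) [IsHaarMeasure μU] (dx : Measure F) [dx.IsAddHaarMeasure]
    {E : Set (Matrix (Fin 3) (Fin 3) F)} (hE : MeasurableSet E)
    (hE0 : (Measure.pi fun _ : Fin 7 => dx) {r : Fin 7 → F | (!![r 0, r 1, r 2; r 3, r 4, r 5; 0, 0, r 6] : Matrix (Fin 3) (Fin 3) F) ∈ E} = 0) :
    (νM.prod μU) {p : ↥(standardLeviGL F (![false, false, true] : Fin 3 → Bool)) × ↥(unipotentRadicalGL F (![false, false, true] : Fin 3 → Bool)) |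
      (((p.1 : GL (Fin 3) F) * (p.2 : GL (Fin 3) F) : GL (Fin 3) F) : Matrix (Fin 3) (Fin 3) F) ∈ E} = 0 := by
  classical
  haveI : T2Space F := (isLocalField F).toT2Space
  haveI : SecondCountableTopology F := secondCountableTopology_localField F
  haveI : IsTopologicalRing F := inferInstance
  haveI : SecondCountableTopology (Matrix (Fin 3) (Fin 3) F) := inferInstanceAs (SecondCountableTopology (Fin 3 → Fin 3 → F))
  haveI : SecondCountableTopology (Matrix (Fin 3) (Fin 3) F)ᵐᵒᵖ := MulOpposite.opHomeomorph.symm.secondCountableTopology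
  haveI : SecondCountableTopology (GL (Fin 3) F) := Units.isEmbedding_embedProduct.secondCountableTopology
  haveI : SecondCountableTopology ↥(standardLeviGL F (![false, false, true] : Fin 3 → Bool)) := TopologicalSpace.Subtype.secondCountableTopology _
  haveI : SecondCountableTopology ↥(unipotentRadicalGL F (![false, false, true] : Fin 3 → Bool)) := TopologicalSpace.Subtype.secondCountableTopology _
  haveI : BorelSpace ↥(standardLeviGL F (![false, false, true] : Fin 3 → Bool)) := Subtype.borelSpace _
  haveI : BorelSpace ↥(unipotentRadicalGL F (![false, false, true] : Fin 3 → Bool)) := Subtype.borelSpace _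
  haveI : LocallyCompactSpace F := (isLocalField F).toLocallyCompactSpace
  haveI : LocallyCompactSpace (Matrix (Fin 3) (Fin 3) F) := inferInstanceAs (LocallyCompactSpace (Fin 3 → Fin 3 → F))
  haveI : LocallyCompactSpace (GL (Fin 3) F) := inferInstance
  haveI : SigmaCompactSpace (GL (Fin 3) F) := sigmaCompactSpace_of_locallyCompact_secondCountable
  haveI : LocallyCompactSpace ↥(unipotentRadicalGL F (![false, false, true] : Fin 3 → Bool)) :=
    (isClosed_unipotentRadicalGL (R := F) (![false, false, true] : Fin 3 → Bool)).locallyCompactSpace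
  haveI : SigmaCompactSpace ↥(unipotentRadicalGL F (![false, false, true] : Fin 3 → Bool)) :=
    (isClosed_unipotentRadicalGL (R := F) (![false, false, true] : Fin 3 → Bool)).isClosedEmbedding_subtypeVal.sigmaCompactSpace
  haveI : SFinite μU := inferInstance
  have hmul : Measurable fun p : ↥(standardLeviGL F (![false, false, true] : Fin 3 → Bool)) × ↥(unipotentRadicalGL F (![false, false, true] : Fin 3 → Bool)) =>
      (((p.1 : GL (Fin 3) F) * (p.2 : GL (Fin 3) F) : GL (Fin 3) F) : Matrix (Fin 3) (Fin 3) F) :=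
    (Units.continuous_val.comp ((continuous_subtype_val.comp continuous_fst).mul (continuous_subtype_val.comp continuous_snd))).measurable
  set S : Set (↥(standardLeviGL F (![false, false, true] : Fin 3 → Bool)) × ↥(unipotentRadicalGL F (![false, false, true] : Fin 3 → Bool))) :=
    {p | (((p.1 : GL (Fin 3) F) * (p.2 : GL (Fin 3) F) : GL (Fin 3) F) : Matrix (Fin 3) (Fin 3) F) ∈ E} with hS
  have hSm : MeasurableSet S := hE.preimage hmul
  obtain ⟨c, -, -, hMUid⟩ := exists_lintegral_levi_unipotent_eq_mul_lintegral_pi (F := F) νM μU dx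
  -- the left-hand side at `g = 1_E` is the product measure of `S`
  have hL : ∫⁻ m, ∫⁻ u, E.indicator (1 : Matrix (Fin 3) (Fin 3) F → ℝ≥0∞)
      (((m : GL (Fin 3) F) * (u : GL (Fin 3) F) : GL (Fin 3) F) : Matrix (Fin 3) (Fin 3) F) ∂μU ∂νM = (νM.prod μU) S := by
    rw [← lintegral_indicator_one hSm, lintegral_prod _ ((measurable_one.indicator hSm).aemeasurable)]
    refine lintegral_congr fun m => lintegral_congr fun u => ?_
    exact (Set.indicator_comp_right (fun p : ↥(standardLeviGL F (![false, false, true] : Fin 3 → Bool)) ×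
      ↥(unipotentRadicalGL F (![false, false, true] : Fin 3 → Bool)) =>
      (((p.1 : GL (Fin 3) F) * (p.2 : GL (Fin 3) F) : GL (Fin 3) F) : Matrix (Fin 3) (Fin 3) F)) (g := (1 : Matrix (Fin 3) (Fin 3) F → ℝ≥0∞)) (x := (m, u)))
  -- the right-hand side vanishes: its integrand is supported in the `dx⁷`-null set `{r | Y(r) ∈ E}`
  set S₀ : Set (Fin 7 → F) := {r : Fin 7 → F | (!![r 0, r 1; r 3, r 4] : Matrix (Fin 2) (Fin 2) F).det ≠ 0 ∧ r 6 ≠ 0} with hS₀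
  have hbm : Measurable fun r : Fin 7 → F => (!![r 0, r 1, r 2; r 3, r 4, r 5; 0, 0, r 6] : Matrix (Fin 3) (Fin 3) F) := by
    refine Continuous.measurable (continuous_matrix fun i j => ?_)
    fin_cases i <;> fin_cases j <;> simp <;> fun_prop
  have hR : ∫⁻ r : Fin 7 → F, S₀.indicator (fun r => E.indicator (1 : Matrix (Fin 3) (Fin 3) F → ℝ≥0∞) !![r 0, r 1, r 2; r 3, r 4, r 5; 0, 0, r 6] *
          ((((normAbs F ((!![r 0, r 1; r 3, r 4] : Matrix (Fin 2) (Fin 2) F).det)⁻¹ : ℝ≥0) : ℝ≥0∞) ^ 3 * ((normAbs F (r 6)⁻¹ : ℝ≥0) : ℝ≥0∞)))) r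
      ∂(Measure.pi fun _ : Fin 7 => dx) = 0 := by
    refine le_antisymm ?_ bot_le
    calc ∫⁻ r : Fin 7 → F, S₀.indicator (fun r => E.indicator (1 : Matrix (Fin 3) (Fin 3) F → ℝ≥0∞) !![r 0, r 1, r 2; r 3, r 4, r 5; 0, 0, r 6] *
          ((((normAbs F ((!![r 0, r 1; r 3, r 4] : Matrix (Fin 2) (Fin 2) F).det)⁻¹ : ℝ≥0) : ℝ≥0∞) ^ 3 * ((normAbs F (r 6)⁻¹ : ℝ≥0) : ℝ≥0∞)))) r
          ∂(Measure.pi fun _ : Fin 7 => dx)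
        ≤ ∫⁻ r : Fin 7 → F, {r : Fin 7 → F | (!![r 0, r 1, r 2; r 3, r 4, r 5; 0, 0, r 6] : Matrix (Fin 3) (Fin 3) F) ∈ E}.indicator
            (fun r => ((((normAbs F ((!![r 0, r 1; r 3, r 4] : Matrix (Fin 2) (Fin 2) F).det)⁻¹ : ℝ≥0) : ℝ≥0∞) ^ 3 * ((normAbs F (r 6)⁻¹ : ℝ≥0) : ℝ≥0∞)))) r
            ∂(Measure.pi fun _ : Fin 7 => dx) := by
          refine lintegral_mono fun r => ?_
          by_cases hr : (!![r 0, r 1, r 2; r 3, r 4, r 5; 0, 0, r 6] : Matrix (Fin 3) (Fin 3) F) ∈ E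
          · rw [indicator_of_mem (show r ∈ {r : Fin 7 → F | (!![r 0, r 1, r 2; r 3, r 4, r 5; 0, 0, r 6] : Matrix (Fin 3) (Fin 3) F) ∈ E} from hr)]
            by_cases hr0 : r ∈ S₀
            · rw [indicator_of_mem hr0, indicator_of_mem hr, Pi.one_apply, one_mul]
            · rw [indicator_of_notMem hr0]; exact bot_le
          · by_cases hr0 : r ∈ S₀
            · rw [indicator_of_mem hr0, indicator_of_notMem hr, zero_mul]; exact bot_le
            · rw [indicator_of_notMem hr0]; exact bot_le
      _ = ∫⁻ r in {r : Fin 7 → F | (!![r 0, r 1, r 2; r 3, r 4, r 5; 0, 0, r 6] : Matrix (Fin 3) (Fin 3) F) ∈ E},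
            ((((normAbs F ((!![r 0, r 1; r 3, r 4] : Matrix (Fin 2) (Fin 2) F).det)⁻¹ : ℝ≥0) : ℝ≥0∞) ^ 3 * ((normAbs F (r 6)⁻¹ : ℝ≥0) : ℝ≥0∞))) ∂(Measure.pi fun _ : Fin 7 => dx) :=
          lintegral_indicator (hE.preimage hbm) _
      _ = 0 := by rw [Measure.restrict_eq_zero.2 hE0, lintegral_zero_measure]
  have h := hMUid (E.indicator 1) (measurable_one.indicator hE)
  rw [hL, hR, mul_zero] at h
  exact h

end MU

/-! ## §2  (AC) for `P₍₂,₁₎`, hypothesis-free, in the tie's shape -/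

/-- **(nsc-K𝔭-AC): THE `K M U` PUSH-FORWARD OF `P₍₂,₁₎ ⊂ GL₃(F)` IS ABSOLUTELY CONTINUOUS.**  For a non-archimedean local field `F`, any Borel structure on
`GL₃(F)`, a Haar measure `μ₀` of `GL₃(F)`, Haar measures `ν_M` on `M₍₂,₁₎ = standardLeviGL F ![false,false,true]`, `μ_U` on `U₍₂,₁₎`, `μ_K` on `K = GL₃(𝒪)`, and
every measurable `A` with `μ₀(A) = 0`: `(μ_K ⊗ (ν_M ⊗ μ_U)) {(k, m, u) | k⁻¹ · (m u) · k ∈ A} = 0` (van Dijk–KMU spelling).  Proof: (i) ★ `μ𝔤(val A) = 0`; (ii) ★ (3E)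
`ℝ≥0∞` identity at `1_{val A}` ⇒ `dx⁷{r | k Y(r) k⁻¹ ∈ val A} = 0` for `μ_K`-a.e. `k`; (iii) §1 at the conjugated set; (iv) inversion invariance of `μ_K`; (v) Tonelli.
This is EXACTLY the hypothesis `hAC` of ★ (nsc-vD-gen) `charLocIntNear_parabolicIndGL_of_ac` for the label `![false,false,true]`.
[cite: HarishChandra1970, Part V §4 Lemma 22] [cite: vanDijk1972, Thm. p. 237] [cite: WeilBNT1967, Ch. II §5] -/
theorem parabolicKMU_null_of_haar_null :
    ∀ (F : Type) [Field F] [ValuativeRel F] [TopologicalSpace F] [IsNonarchimedeanLocalField F]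
      [MeasurableSpace (GL (Fin 3) F)] [BorelSpace (GL (Fin 3) F)] (μ₀ : Measure (GL (Fin 3) F)) [μ₀.IsHaarMeasure]
      (νM : Measure ↥(standardLeviGL F (![false, false, true] : Fin 3 → Bool))) [νM.IsHaarMeasure]
      (μU : Measure ↥(unipotentRadicalGL F (![false, false, true] : Fin 3 → Bool))) [μU.IsHaarMeasure]
      (μK : Measure ↥(glInt 3 F)) [μK.IsHaarMeasure] (A : Set (GL (Fin 3) F)), MeasurableSet A → μ₀ A = 0 →
      (μK.prod (νM.prod μU)) {t : ↥(glInt 3 F) × (↥(standardLeviGL F (![false, false, true] : Fin 3 → Bool)) ×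
          ↥(unipotentRadicalGL F (![false, false, true] : Fin 3 → Bool))) |
        ((t.1 : GL (Fin 3) F))⁻¹ * ((t.2.1 : GL (Fin 3) F) * (t.2.2 : GL (Fin 3) F)) * (t.1 : GL (Fin 3) F) ∈ A} = 0 := by
  intro F _ _ _ _ _ _ μ₀ _ νM _ μU _ μK _ A hA hA0
  classical
  -- §0 frame (Borel structures on `F` and `M₃(F)` are auxiliary)
  letI : MeasurableSpace F := borel F
  haveI : BorelSpace F := ⟨rfl⟩
  letI : MeasurableSpace (Matrix (Fin 3) (Fin 3) F) := borel _
  haveI : BorelSpace (Matrix (Fin 3) (Fin 3) F) := ⟨rfl⟩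
  haveI : T2Space F := (isLocalField F).toT2Space
  haveI : LocallyCompactSpace F := (isLocalField F).toLocallyCompactSpace
  haveI : SecondCountableTopology F := secondCountableTopology_localField F
  haveI : IsTopologicalRing F := inferInstance
  haveI : T2Space (GL (Fin 3) F) := t2Space_generalLinearGroup F 3
  haveI : T2Space (Matrix (Fin 3) (Fin 3) F) := inferInstanceAs (T2Space (Fin 3 → Fin 3 → F))
  haveI : SecondCountableTopology (Matrix (Fin 3) (Fin 3) F) := inferInstanceAs (SecondCountableTopology (Fin 3 → Fin 3 → F))
  haveI : LocallyCompactSpace (Matrix (Fin 3) (Fin 3) F) := Pi.locallyCompactSpace_of_finite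
  haveI : SecondCountableTopology (Matrix (Fin 3) (Fin 3) F)ᵐᵒᵖ := MulOpposite.opHomeomorph.symm.secondCountableTopology
  haveI : SecondCountableTopology (GL (Fin 3) F) := Units.isEmbedding_embedProduct.secondCountableTopology
  haveI : SecondCountableTopology ↥(glInt 3 F) := TopologicalSpace.Subtype.secondCountableTopology _
  haveI : SecondCountableTopology ↥(standardLeviGL F (![false, false, true] : Fin 3 → Bool)) := TopologicalSpace.Subtype.secondCountableTopology _
  haveI : SecondCountableTopology ↥(unipotentRadicalGL F (![false, false, true] : Fin 3 → Bool)) := TopologicalSpace.Subtype.secondCountableTopology _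
  haveI : BorelSpace ↥(glInt 3 F) := Subtype.borelSpace _
  haveI : BorelSpace ↥(standardLeviGL F (![false, false, true] : Fin 3 → Bool)) := Subtype.borelSpace _
  haveI : BorelSpace ↥(unipotentRadicalGL F (![false, false, true] : Fin 3 → Bool)) := Subtype.borelSpace _
  haveI : CompactSpace ↥(glInt 3 F) := isCompact_iff_compactSpace.1 (isCompact_glInt (n := 3) (F := F))
  haveI : μK.IsInvInvariant := Literature.MeasureTheory.Group.HaarLocalChart.isInvInvariant_of_isHaarMeasure μK
  set dx : Measure F := Measure.addHaar with hdx
  haveI : SFinite (Measure.pi fun _ : Fin 7 => dx) := inferInstance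
  have hme : MeasurableEmbedding (Units.val : GL (Fin 3) F → Matrix (Fin 3) (Fin 3) F) := measurableEmbedding_generalLinearGroup_val
  -- an auxiliary additive Haar measure on `M₃(F)` and the image `E = val A`
  set μ𝔤 : Measure (Matrix (Fin 3) (Fin 3) F) := Measure.addHaar with hμ𝔤
  set E : Set (Matrix (Fin 3) (Fin 3) F) := Units.val '' A with hE
  have hEm : MeasurableSet E := hme.measurableSet_image.2 hA
  have hE0 : μ𝔤 E = 0 := addHaar_image_val_eq_zero_of_haar_eq_zero μ𝔤 μ₀ hA hA0
  -- §1 the (3E) slice identity against `1_E`: `∫_K dx⁷{r | k Y(r) k⁻¹ ∈ E} dμ_K = 0`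
  obtain ⟨C, -, -, hid⟩ := exists_lintegral_parabolicSlice_eq_lintegral_mul_density (F := F) μK dx μ𝔤
    (K2E3GL3CharpolyDiscNull.pi_setOf_discr_charpoly_parabolic_eq_zero (F := F) dx)
  set Φ : ↥(glInt 3 F) → ℝ≥0∞ := fun k => ∫⁻ r : Fin 7 → F,
    E.indicator (1 : Matrix (Fin 3) (Fin 3) F → ℝ≥0∞) (((k : GL (Fin 3) F) : Matrix (Fin 3) (Fin 3) F) * !![r 0, r 1, r 2; r 3, r 4, r 5; 0, 0, r 6] *
      ((((k : GL (Fin 3) F))⁻¹ : GL (Fin 3) F) : Matrix (Fin 3) (Fin 3) F)) ∂(Measure.pi fun _ : Fin 7 => dx) with hΦ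
  have hjoint : Measurable fun p : ↥(glInt 3 F) × (Fin 7 → F) =>
      ((p.1 : GL (Fin 3) F) : Matrix (Fin 3) (Fin 3) F) * !![p.2 0, p.2 1, p.2 2; p.2 3, p.2 4, p.2 5; 0, 0, p.2 6] *
        ((((p.1 : GL (Fin 3) F))⁻¹ : GL (Fin 3) F) : Matrix (Fin 3) (Fin 3) F) := by
    refine Continuous.measurable ?_
    refine (((Units.continuous_val.comp (continuous_subtype_val.comp continuous_fst))).mul ?_).mul
      (Units.continuous_coe_inv.comp (continuous_subtype_val.comp continuous_fst))
    refine continuous_matrix fun i j => ?_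
    fin_cases i <;> fin_cases j <;> simp <;> fun_prop
  have hΦm : Measurable Φ := ((measurable_one.indicator hEm).comp hjoint).lintegral_prod_right'
  have hΦ0 : ∫⁻ k, Φ k ∂μK = 0 := by
    rw [hΦ, hid (E.indicator 1) (measurable_one.indicator hEm)]
    refine le_antisymm ?_ bot_le
    calc ∫⁻ X, E.indicator (1 : Matrix (Fin 3) (Fin 3) F → ℝ≥0∞) X * ({X : Matrix (Fin 3) (Fin 3) F | X.charpoly.discr ≠ 0}).indicator
            (fun X => C * (X.charpoly.roots.map fun a => (((normAbs F (X.charpoly.derivative.eval a))⁻¹ : ℝ≥0) : ℝ≥0∞)).sum) X ∂μ𝔤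
        = ∫⁻ X in E, ({X : Matrix (Fin 3) (Fin 3) F | X.charpoly.discr ≠ 0}).indicator
            (fun X => C * (X.charpoly.roots.map fun a => (((normAbs F (X.charpoly.derivative.eval a))⁻¹ : ℝ≥0) : ℝ≥0∞)).sum) X ∂μ𝔤 := by
          rw [← lintegral_indicator hEm]
          refine lintegral_congr fun X => ?_
          by_cases hX : X ∈ E
          · rw [indicator_of_mem hX, indicator_of_mem hX, Pi.one_apply, one_mul]
          · rw [indicator_of_notMem hX, indicator_of_notMem hX, zero_mul]
      _ = 0 := by rw [Measure.restrict_eq_zero.2 hE0, lintegral_zero_measure]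
      _ ≤ 0 := le_rfl
  have hΦae : Φ =ᵐ[μK] 0 := (lintegral_eq_zero_iff hΦm).1 hΦ0
  -- membership in `A` read on matrices
  have hmemE : ∀ g : GL (Fin 3) F, (g : Matrix (Fin 3) (Fin 3) F) ∈ E ↔ g ∈ A := fun g =>
    ⟨fun ⟨g', hg', hgg'⟩ => Units.ext hgg' ▸ hg', fun hg => ⟨g, hg, rfl⟩⟩
  -- §2 the conjugated sets `E_k = {X | k X k⁻¹ ∈ E}` and (MU)
  have hbm : Measurable fun r : Fin 7 → F => (!![r 0, r 1, r 2; r 3, r 4, r 5; 0, 0, r 6] : Matrix (Fin 3) (Fin 3) F) := by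
    refine Continuous.measurable (continuous_matrix fun i j => ?_)
    fin_cases i <;> fin_cases j <;> simp <;> fun_prop
  have hconj : ∀ k : ↥(glInt 3 F), Φ k = 0 →
      (νM.prod μU) {p : ↥(standardLeviGL F (![false, false, true] : Fin 3 → Bool)) × ↥(unipotentRadicalGL F (![false, false, true] : Fin 3 → Bool)) |
        (((k : GL (Fin 3) F) * ((p.1 : GL (Fin 3) F) * (p.2 : GL (Fin 3) F)) * ((k : GL (Fin 3) F))⁻¹ : GL (Fin 3) F) : Matrix (Fin 3) (Fin 3) F) ∈ E} = 0 := by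
    intro k hk
    have hck : Continuous fun X : Matrix (Fin 3) (Fin 3) F => ((k : GL (Fin 3) F) : Matrix (Fin 3) (Fin 3) F) * X *
        ((((k : GL (Fin 3) F))⁻¹ : GL (Fin 3) F) : Matrix (Fin 3) (Fin 3) F) := (continuous_const.mul continuous_id).mul continuous_const
    have hEkm : MeasurableSet ((fun X : Matrix (Fin 3) (Fin 3) F => ((k : GL (Fin 3) F) : Matrix (Fin 3) (Fin 3) F) * X *
        ((((k : GL (Fin 3) F))⁻¹ : GL (Fin 3) F) : Matrix (Fin 3) (Fin 3) F)) ⁻¹' E) := hEm.preimage hck.measurable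
    have hpre_m : MeasurableSet ((fun r : Fin 7 → F => ((k : GL (Fin 3) F) : Matrix (Fin 3) (Fin 3) F) * !![r 0, r 1, r 2; r 3, r 4, r 5; 0, 0, r 6] *
        ((((k : GL (Fin 3) F))⁻¹ : GL (Fin 3) F) : Matrix (Fin 3) (Fin 3) F)) ⁻¹' E) := hEm.preimage (hck.measurable.comp hbm)
    have hΦk : Φ k = (Measure.pi fun _ : Fin 7 => dx) ((fun r : Fin 7 → F => ((k : GL (Fin 3) F) : Matrix (Fin 3) (Fin 3) F) *
        !![r 0, r 1, r 2; r 3, r 4, r 5; 0, 0, r 6] * ((((k : GL (Fin 3) F))⁻¹ : GL (Fin 3) F) : Matrix (Fin 3) (Fin 3) F)) ⁻¹' E) := by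
      rw [hΦ, ← lintegral_indicator_one hpre_m]
      refine lintegral_congr fun r => ?_
      exact (Set.indicator_comp_right (fun r : Fin 7 → F => ((k : GL (Fin 3) F) : Matrix (Fin 3) (Fin 3) F) *
        !![r 0, r 1, r 2; r 3, r 4, r 5; 0, 0, r 6] * ((((k : GL (Fin 3) F))⁻¹ : GL (Fin 3) F) : Matrix (Fin 3) (Fin 3) F)) (g := (1 : Matrix (Fin 3) (Fin 3) F → ℝ≥0∞))).symm
    have hnull : (Measure.pi fun _ : Fin 7 => dx) {r : Fin 7 → F | (!![r 0, r 1, r 2; r 3, r 4, r 5; 0, 0, r 6] : Matrix (Fin 3) (Fin 3) F) ∈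
        (fun X : Matrix (Fin 3) (Fin 3) F => ((k : GL (Fin 3) F) : Matrix (Fin 3) (Fin 3) F) * X *
          ((((k : GL (Fin 3) F))⁻¹ : GL (Fin 3) F) : Matrix (Fin 3) (Fin 3) F)) ⁻¹' E} = 0 := by
      rw [← hk, hΦk]
      rfl
    have h := prod_null_of_levi_unipotent (F := F) νM μU dx hEkm hnull
    have hset_eq : {p : ↥(standardLeviGL F (![false, false, true] : Fin 3 → Bool)) × ↥(unipotentRadicalGL F (![false, false, true] : Fin 3 → Bool)) |
          (((p.1 : GL (Fin 3) F) * (p.2 : GL (Fin 3) F) : GL (Fin 3) F) : Matrix (Fin 3) (Fin 3) F) ∈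
            (fun X : Matrix (Fin 3) (Fin 3) F => ((k : GL (Fin 3) F) : Matrix (Fin 3) (Fin 3) F) * X *
              ((((k : GL (Fin 3) F))⁻¹ : GL (Fin 3) F) : Matrix (Fin 3) (Fin 3) F)) ⁻¹' E} =
        {p | (((k : GL (Fin 3) F) * ((p.1 : GL (Fin 3) F) * (p.2 : GL (Fin 3) F)) * ((k : GL (Fin 3) F))⁻¹ : GL (Fin 3) F) : Matrix (Fin 3) (Fin 3) F) ∈ E} := by
      ext p
      simp only [mem_setOf_eq, mem_preimage, Units.val_mul]
    rw [hset_eq] at h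
    exact h
  -- §3 the target set, its sections, and Tonelli
  set Q : Set (↥(glInt 3 F) × (↥(standardLeviGL F (![false, false, true] : Fin 3 → Bool)) × ↥(unipotentRadicalGL F (![false, false, true] : Fin 3 → Bool)))) :=
    {q | ((q.1 : GL (Fin 3) F))⁻¹ * (((q.2.1 : GL (Fin 3) F)) * (q.2.2 : GL (Fin 3) F)) * (q.1 : GL (Fin 3) F) ∈ A} with hQ
  have hQm : MeasurableSet Q := by
    refine hA.preimage (Continuous.measurable ?_)
    have h1 : Continuous fun q : ↥(glInt 3 F) × (↥(standardLeviGL F (![false, false, true] : Fin 3 → Bool)) ×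
        ↥(unipotentRadicalGL F (![false, false, true] : Fin 3 → Bool))) => (q.1 : GL (Fin 3) F) := continuous_subtype_val.comp continuous_fst
    have h2 : Continuous fun q : ↥(glInt 3 F) × (↥(standardLeviGL F (![false, false, true] : Fin 3 → Bool)) ×
        ↥(unipotentRadicalGL F (![false, false, true] : Fin 3 → Bool))) => (q.2.1 : GL (Fin 3) F) := continuous_subtype_val.comp (continuous_fst.comp continuous_snd)
    have h3 : Continuous fun q : ↥(glInt 3 F) × (↥(standardLeviGL F (![false, false, true] : Fin 3 → Bool)) ×
        ↥(unipotentRadicalGL F (![false, false, true] : Fin 3 → Bool))) => (q.2.2 : GL (Fin 3) F) := continuous_subtype_val.comp (continuous_snd.comp continuous_snd)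
    exact (h1.inv.mul (h2.mul h3)).mul h1
  -- `μ_K`-a.e. `k` has `Φ k⁻¹ = 0` (inversion invariance of `μ_K`)
  have hΦinv : ∀ᵐ k ∂μK, Φ k⁻¹ = 0 := by
    rw [ae_iff]
    have hset : {k : ↥(glInt 3 F) | ¬ Φ k⁻¹ = 0} = {k : ↥(glInt 3 F) | ¬ Φ k = 0}⁻¹ := by
      ext k; simp only [mem_setOf_eq, Set.mem_inv]
    have h0 : μK {k : ↥(glInt 3 F) | ¬ Φ k = 0} = 0 := by rw [← ae_iff]; exact hΦae
    rw [hset, ← Measure.inv_apply, Measure.inv_eq_self, h0]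
  refine measure_prod_null_of_ae_null hQm ?_
  filter_upwards [hΦinv] with k hk
  have h := hconj k⁻¹ hk
  have hsec : Prod.mk k ⁻¹' Q = {p : ↥(standardLeviGL F (![false, false, true] : Fin 3 → Bool)) × ↥(unipotentRadicalGL F (![false, false, true] : Fin 3 → Bool)) |
      ((((k⁻¹ : ↥(glInt 3 F)) : GL (Fin 3) F) * ((p.1 : GL (Fin 3) F) * (p.2 : GL (Fin 3) F)) * (((k⁻¹ : ↥(glInt 3 F)) : GL (Fin 3) F))⁻¹ : GL (Fin 3) F) :
        Matrix (Fin 3) (Fin 3) F) ∈ E} := by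
    ext p
    simp only [hQ, mem_preimage, mem_setOf_eq, hmemE, InvMemClass.coe_inv, inv_inv]
  rw [hsec]
  exact h

end Summit.HodgeConjecture.HodgeConjecture.Cruxes.H413.K2E3GL3ParabolicKMUAbsCont

end
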